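import Summits.QuantumFields.BalabanUV.T4Continuum.Support.NE7TorusRoadBundle
import HarnessLib

/-!
# NE7HapeOfLocalChart — `hape` ([Balaban1985Variational] Prop. 8's a-priori estimate, the torus road's target) FROM THE LOCAL CHART (N1)-weak AND ONE SCALAR
# LINE: F263's per-plaquette bundle is supplied by F278c `NE7TorusRoadBundle.exists_bundle_of_chart` for every tangent-critical admissible `U`, every plaquette and
# every current radius `r ≤ δ`; what is left of the torus road is (i) the chart — `∀ U, z: ∃ (u, Ã)`, `U^u = e^{Ã}` on the torus ball of radius `(nbRad + 2ℓ + 10)·M`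
# around `z`, `‖Ã‖ ≤ a₀`, `‖δÃ‖ ≤ a₁`, `M a₀ ≤ C₀·t`, `M²a₁ ≤ C₁·t`, `t = r + 4(e^β − 1) + ε` (the shape of [B8] Thm 2 at `U₀ = 1` on nested cubes, VERBATIM (152)) —
# and (ii) the numeric line of F263 at the closed-form constants of F278, a finite inequality among `(K, c, ℓ, ε, δ, β, C₀, C₁, r, a₀, a₁, k)` (next file)

Cell `pub-balaban`, rung (B)+1 sub-cell t4, lineage `b2b-balaban-t4-ne7-p1` (CRUX PROVER NE7 #1 = OWNER of row NE7), generation 90; memo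
`t4/b2b-balaban-t4-ne7-p1-g90/DEFECT-FAR.md` §5.  File F279 (over F263 `NE7ApeOfTorusRoadV4.hape_of_torusRoadV4` and F278c `NE7TorusRoadBundle.exists_bundle_of_chart`).

WHY.  F263 reduced `hape` to a per-plaquette ∃-bundle of lattice objects; F278 discharged the bundle's four structural clauses from a chart.  THIS FILE composes the two:
`hape` now follows from the chart hypothesis `hchart` ((N1)-weak, [B8] Thm 2 TYPE — NOT proved here), the multi-level class smallness of `ε`, F51's smallness of
`C₀(δ + 4(e^β − 1) + ε)`, and the scalar line `hline` — no configuration, no lift, no Green's function remains in the hypotheses.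
WHAT ([folklore] composition; 0 def, 0 sorry; dimension `d + 1`, `L ≥ 2`, `N ≥ 4ℓ + 12`).  **`hape_of_localChart`** (statement spelled in full below).
HONEST FRAMING (page 1): composition BY NAME; `hchart` ((N1)-weak = [B8] Thm 2 at `U₀ = 1`, local, VERBATIM (152); INTERFACE REQUEST NE7 of [NE7P1-G89-INBOX-1]) and
`hline` are HYPOTHESES asserted for nothing; nothing of Bałaban's asserted; NOT (APE) unconditionally, NOT ONE-STEP, NOT NE7; spine 0∕9; finite T⁴ rung (B)+1 — NOT
infinite volume, NOT mass gap, NOT `BetaPertH`, NOT Clay.  Continuum YM on T⁴ ⇐ BetaPertH ∧ nine spine estimates (0/9 proved); BetaPertH ⇐ (D1) ∧ (D4) ∧ CAP+tail;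
G-an2-4 gates asym, D1 and NE2/3/4.
-/

set_option autoImplicit false

open scoped BigOperators Matrix.Norms.L2Operator
open NormedSpace Finset Set

namespace Summit.QuantumFields.BalabanUV.T4Continuum.NE7HapeOfLocalChart

open Literature.MathematicalPhysics.QuantumFieldTheory.Balaban1983to89
open B7Prop1Explicit B7Prop2Explicit MatrixLog UnitaryModel
open B4TorusKernel.MultiPeriod (torusSupNorm)
open T4AveragingDeficitWall (IsUnitaryCfg IsSkewDir SmallField vary curlAt dirL1)
open T4AveragingDeficitWallBoundary (IsPeriodicCfg periodBox)
open AveragingDeficitPeriodicCounting (IsPeriodicDir)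
open AveragingDeficitMultiLevelPrep (LevelSmall TangentIter cavgIter)
open AveragingDeficitMultiLevelBridge (cavgIter_eq_avgIter)
open BlockAverageVaryHolo (nbRad)
open BlockAverageVaryDisc (rho0)
open MinimalActionLevels (perWin)
open MinimalActionSandwich (admissible)
open MinimalActionRate (sfClass)
open NE3HessForm (dAction)
open NE3TangentCovariantTower (dirIter)
open NE3TangentFlatStructure (Qcoarse)
open B5Prop11Plancherel (Tor fine)
open B5Blocks16 (blockOf)
open B6LowerBound2153Torus (toT rep)
open B4Sect5Proof (latticeConst)
open B5Hk163Strip (kappa163)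
open B5Hk163TorusHolderDecay (CdecD)
open NE3QbarIterCovLiftPrep (cruxC)
open NE3RightInverseSolveLetters (thetaLoc)
open NE3HatInvCurlLetters (curl1C curl1C_nonneg)
open NE3EnergyShapes (IsUnitarySite)
open BlockAveragePushDirSplit (flat)
open NE7ApeOfTorusRoadV4 (hape_of_torusRoadV4)
open NE7TorusRoadBundle (exists_bundle_of_chart)

noncomputable section

variable {d : ℕ} {n : Type*} [Fintype n] [DecidableEq n]

/-- The closed-form defect densities of F278 are non-negative (`r, a₀, a₁ ≥ 0`, `thetaLoc·ε < 1`). [folklore] -/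
theorem densities_nonneg {L : ℕ} (hL : 2 ≤ L) (k : ℕ) {ε r a₀ a₁ : ℝ} (hθl : thetaLoc (d + 1) L * ε < 1) (hr0 : 0 ≤ r) (ha₀ : 0 ≤ a₀) (ha₁ : 0 ≤ a₁) :
    0 ≤ (r * ((L : ℝ) ^ (k + 1) * a₀) * ((curl1C (d + 1) L / (1 - thetaLoc (d + 1) L * ε))
                * (2 * (8 * (3 + 12 * ((d + 1 : ℕ) : ℝ)) * (2 + 2 * ((((d + 1 : ℕ) : ℝ) + 1) * L)
                  * (1 + ((1250 * ((nbRad (d + 1) L : ℝ) + L) + 8 * (((d + 1 : ℕ) : ℝ) * L) + 2 * L)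
                      * (((d + 1 : ℕ) : ℝ) * (2 * nbRad (d + 1) L + 1) ^ (d + 1))) / ((L : ℝ) / (L : ℝ) ^ (d + 1)))))))
              / ((L : ℝ) ^ (k + 1)) ^ 3
            + ((Fintype.card (T4AveragingDeficitWall.Plane (d + 1)) : ℝ)
              * (2 * (8 * a₀ * (2 * a₁ + 28 * a₀ ^ 2) + 6 * (Real.exp a₀ - 1) * (2 * a₁ + 24 * (Real.exp a₀ - 1) * a₀)
                  + (2 * a₁ + 24 * (Real.exp a₀ - 1) * a₀) * (2 * a₁ + 28 * a₀ ^ 2) + 960 * (Real.exp a₀ - 1) * a₀ ^ 2)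
                + 64 * a₀ * a₁))
            + ((Fintype.card (T4AveragingDeficitWall.Plane (d + 1)) : ℝ)
              * (2 * (8 * a₀ * (2 * (a₁ + 1 / (L : ℝ) ^ (k + 1) * a₀) + 28 * a₀ ^ 2)
                  + 6 * (Real.exp a₀ - 1) * (2 * (a₁ + 1 / (L : ℝ) ^ (k + 1) * a₀) + 24 * (Real.exp a₀ - 1) * a₀)
                  + (2 * (a₁ + 1 / (L : ℝ) ^ (k + 1) * a₀) + 24 * (Real.exp a₀ - 1) * a₀) * (2 * (a₁ + 1 / (L : ℝ) ^ (k + 1) * a₀) + 28 * a₀ ^ 2)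
                  + 960 * (Real.exp a₀ - 1) * a₀ ^ 2)
                + 64 * a₀ * (a₁ + 1 / (L : ℝ) ^ (k + 1) * a₀)))) ∧
    0 ≤ ((r * ((L : ℝ) ^ (k + 1) * a₀) * ((curl1C (d + 1) L / (1 - thetaLoc (d + 1) L * ε))
                * (2 * (8 * (3 + 12 * ((d + 1 : ℕ) : ℝ)) * (2 + 2 * ((((d + 1 : ℕ) : ℝ) + 1) * L)
                  * (1 + ((1250 * ((nbRad (d + 1) L : ℝ) + L) + 8 * (((d + 1 : ℕ) : ℝ) * L) + 2 * L)
                      * (((d + 1 : ℕ) : ℝ) * (2 * nbRad (d + 1) L + 1) ^ (d + 1))) / ((L : ℝ) / (L : ℝ) ^ (d + 1)))))))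
              / ((L : ℝ) ^ (k + 1)) ^ 3
            + ((Fintype.card (T4AveragingDeficitWall.Plane (d + 1)) : ℝ)
              * (2 * (8 * a₀ * (2 * a₁ + 28 * a₀ ^ 2) + 6 * (Real.exp a₀ - 1) * (2 * a₁ + 24 * (Real.exp a₀ - 1) * a₀)
                  + (2 * a₁ + 24 * (Real.exp a₀ - 1) * a₀) * (2 * a₁ + 28 * a₀ ^ 2) + 960 * (Real.exp a₀ - 1) * a₀ ^ 2)
                + 64 * a₀ * a₁))
            + ((Fintype.card (T4AveragingDeficitWall.Plane (d + 1)) : ℝ)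
              * (2 * (8 * a₀ * (2 * (a₁ + 1 / (L : ℝ) ^ (k + 1) * a₀) + 28 * a₀ ^ 2)
                  + 6 * (Real.exp a₀ - 1) * (2 * (a₁ + 1 / (L : ℝ) ^ (k + 1) * a₀) + 24 * (Real.exp a₀ - 1) * a₀)
                  + (2 * (a₁ + 1 / (L : ℝ) ^ (k + 1) * a₀) + 24 * (Real.exp a₀ - 1) * a₀) * (2 * (a₁ + 1 / (L : ℝ) ^ (k + 1) * a₀) + 28 * a₀ ^ 2)
                  + 960 * (Real.exp a₀ - 1) * a₀ ^ 2)
                + 64 * a₀ * (a₁ + 1 / (L : ℝ) ^ (k + 1) * a₀))))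
            + r * (curl1C (d + 1) L / (1 - thetaLoc (d + 1) L * ε)) / ((L : ℝ) ^ (k + 1)) ^ 3
            + 2 * (Fintype.card (T4AveragingDeficitWall.Plane (d + 1)) : ℝ)
              * (2 * (1 / (L : ℝ) ^ (k + 1)) * a₁ + 2 / ((L : ℝ) ^ (k + 1)) ^ 2 * a₀)) := by
  have hLpos : (0 : ℝ) < L := by exact_mod_cast (by omega : 0 < L)
  have hMpos : (0 : ℝ) < (L : ℝ) ^ (k + 1) := by positivity
  have hKd0 : (0 : ℝ) ≤ (8 * (3 + 12 * ((d + 1 : ℕ) : ℝ)) * (2 + 2 * ((((d + 1 : ℕ) : ℝ) + 1) * L)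
        * (1 + ((1250 * ((nbRad (d + 1) L : ℝ) + L) + 8 * (((d + 1 : ℕ) : ℝ) * L) + 2 * L) * (((d + 1 : ℕ) : ℝ) * (2 * nbRad (d + 1) L + 1) ^ (d + 1)))
          / ((L : ℝ) / (L : ℝ) ^ (d + 1))))) := by positivity
  have hCc : 0 ≤ curl1C (d + 1) L / (1 - thetaLoc (d + 1) L * ε) := div_nonneg (curl1C_nonneg (d + 1) L) (by linarith)
  have hδe : 0 ≤ Real.exp a₀ - 1 := by linarith [Real.add_one_le_exp a₀]
  have hρa : 0 ≤ ((Fintype.card (T4AveragingDeficitWall.Plane (d + 1)) : ℝ)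
        * (2 * (8 * a₀ * (2 * a₁ + 28 * a₀ ^ 2) + 6 * (Real.exp a₀ - 1) * (2 * a₁ + 24 * (Real.exp a₀ - 1) * a₀)
            + (2 * a₁ + 24 * (Real.exp a₀ - 1) * a₀) * (2 * a₁ + 28 * a₀ ^ 2) + 960 * (Real.exp a₀ - 1) * a₀ ^ 2)
          + 64 * a₀ * a₁)) := by positivity
  have hρb : 0 ≤ ((Fintype.card (T4AveragingDeficitWall.Plane (d + 1)) : ℝ)
        * (2 * (8 * a₀ * (2 * (a₁ + 1 / (L : ℝ) ^ (k + 1) * a₀) + 28 * a₀ ^ 2) + 6 * (Real.exp a₀ - 1) * (2 * (a₁ + 1 / (L : ℝ) ^ (k + 1) * a₀) + 24 * (Real.exp a₀ - 1) * a₀)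
            + (2 * (a₁ + 1 / (L : ℝ) ^ (k + 1) * a₀) + 24 * (Real.exp a₀ - 1) * a₀) * (2 * (a₁ + 1 / (L : ℝ) ^ (k + 1) * a₀) + 28 * a₀ ^ 2) + 960 * (Real.exp a₀ - 1) * a₀ ^ 2)
          + 64 * a₀ * (a₁ + 1 / (L : ℝ) ^ (k + 1) * a₀))) := by positivity
  have hX : 0 ≤ r * ((L : ℝ) ^ (k + 1) * a₀) * (curl1C (d + 1) L / (1 - thetaLoc (d + 1) L * ε) * (2 * (8 * (3 + 12 * ((d + 1 : ℕ) : ℝ)) * (2 + 2 * ((((d + 1 : ℕ) : ℝ) + 1) * L)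
        * (1 + ((1250 * ((nbRad (d + 1) L : ℝ) + L) + 8 * (((d + 1 : ℕ) : ℝ) * L) + 2 * L) * (((d + 1 : ℕ) : ℝ) * (2 * nbRad (d + 1) L + 1) ^ (d + 1)))
          / ((L : ℝ) / (L : ℝ) ^ (d + 1)))))))
      / ((L : ℝ) ^ (k + 1)) ^ 3 :=
    div_nonneg (mul_nonneg (mul_nonneg hr0 (mul_nonneg hMpos.le ha₀)) (mul_nonneg hCc (mul_nonneg zero_le_two hKd0))) (pow_nonneg hMpos.le 3)
  have hXq : 0 ≤ r * (curl1C (d + 1) L / (1 - thetaLoc (d + 1) L * ε)) / ((L : ℝ) ^ (k + 1)) ^ 3 :=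
    div_nonneg (mul_nonneg hr0 hCc) (pow_nonneg hMpos.le 3)
  have hCm : 0 ≤ 2 * (Fintype.card (T4AveragingDeficitWall.Plane (d + 1)) : ℝ) * (2 * (1 / (L : ℝ) ^ (k + 1)) * a₁ + 2 / ((L : ℝ) ^ (k + 1)) ^ 2 * a₀) := by
    positivity
  have hτn : 0 ≤ (r * ((L : ℝ) ^ (k + 1) * a₀) * ((curl1C (d + 1) L / (1 - thetaLoc (d + 1) L * ε))
                * (2 * (8 * (3 + 12 * ((d + 1 : ℕ) : ℝ)) * (2 + 2 * ((((d + 1 : ℕ) : ℝ) + 1) * L)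
                  * (1 + ((1250 * ((nbRad (d + 1) L : ℝ) + L) + 8 * (((d + 1 : ℕ) : ℝ) * L) + 2 * L)
                      * (((d + 1 : ℕ) : ℝ) * (2 * nbRad (d + 1) L + 1) ^ (d + 1))) / ((L : ℝ) / (L : ℝ) ^ (d + 1)))))))
              / ((L : ℝ) ^ (k + 1)) ^ 3
            + ((Fintype.card (T4AveragingDeficitWall.Plane (d + 1)) : ℝ)
              * (2 * (8 * a₀ * (2 * a₁ + 28 * a₀ ^ 2) + 6 * (Real.exp a₀ - 1) * (2 * a₁ + 24 * (Real.exp a₀ - 1) * a₀)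
                  + (2 * a₁ + 24 * (Real.exp a₀ - 1) * a₀) * (2 * a₁ + 28 * a₀ ^ 2) + 960 * (Real.exp a₀ - 1) * a₀ ^ 2)
                + 64 * a₀ * a₁))
            + ((Fintype.card (T4AveragingDeficitWall.Plane (d + 1)) : ℝ)
              * (2 * (8 * a₀ * (2 * (a₁ + 1 / (L : ℝ) ^ (k + 1) * a₀) + 28 * a₀ ^ 2)
                  + 6 * (Real.exp a₀ - 1) * (2 * (a₁ + 1 / (L : ℝ) ^ (k + 1) * a₀) + 24 * (Real.exp a₀ - 1) * a₀)
                  + (2 * (a₁ + 1 / (L : ℝ) ^ (k + 1) * a₀) + 24 * (Real.exp a₀ - 1) * a₀) * (2 * (a₁ + 1 / (L : ℝ) ^ (k + 1) * a₀) + 28 * a₀ ^ 2)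
                  + 960 * (Real.exp a₀ - 1) * a₀ ^ 2)
                + 64 * a₀ * (a₁ + 1 / (L : ℝ) ^ (k + 1) * a₀)))) := add_nonneg (add_nonneg hX hρa) hρb
  exact ⟨hτn, add_nonneg (add_nonneg hτn hXq) hCm⟩

/-- F263's per-plaquette bundle WITH its numeric line, from the chart at one plaquette and the line at the closed-form constants (F278c packaged for F263's
`hloc`). [folklore] -/
theorem bundle_with_line_of_chart [Nonempty n] {L : ℕ} [NeZero L] (hL : 2 ≤ L) (k : ℕ) {N ℓ : ℕ} [NeZero N] (hℓ : 1 ≤ ℓ) (hN : 4 * ℓ + 12 ≤ N)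
    -- the class radius `ε∕M²` (multi-level smallness) and the current radius `r∕M²`
    {ε r β' : ℝ} (hε : 0 ≤ ε) (hLS : LevelSmall (d + 1) L k (ε / ((L : ℝ) ^ (k + 1)) ^ 2))
    (hθ : cruxC (d + 1) L * ε < 1) (hθl : thetaLoc (d + 1) L * ε < 1) (hε1 : ε ≤ 1) (hr : 0 ≤ r) (hβ' : 0 ≤ β')
    -- the configuration: unitary, periodic, in the class, tangent-critical, with datum `D` of plaquette radius `β′`
    {U D : Site (d + 1) → Fin (d + 1) → (Matrix n n ℂ)ˣ} (hUu : IsUnitaryCfg U) (hUP : IsPeriodicCfg U ((N * L ^ (k + 1) : ℕ) : ℤ))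
    (hUε : SmallField U (ε / ((L : ℝ) ^ (k + 1)) ^ 2)) (hUr : SmallField U (r / ((L : ℝ) ^ (k + 1)) ^ 2))
    (havg : cavgIter L (k + 1) U = D) (hD : SmallField D β')
    (hcrit : ∀ φ : Site (d + 1) → Fin (d + 1) → Matrix n n ℂ, IsSkewDir φ → IsPeriodicDir φ ((N * L ^ (k + 1) : ℕ) : ℤ) → TangentIter L k U φ →
      dAction U φ (perWin (d + 1) (N * L ^ (k + 1))) = 0)
    -- the plaquette and the chart around it
    (z : Site (d + 1)) (μ ν : Fin (d + 1))
    {u : Site (d + 1) → (Matrix n n ℂ)ˣ} (hu : IsUnitarySite u) (huP : ∀ (y : Site (d + 1)) (i : Fin (d + 1)), u (y + ((N * L ^ (k + 1) : ℕ) : ℤ) • e i) = u y)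
    {At : Site (d + 1) → Fin (d + 1) → Matrix n n ℂ} (hAt : IsSkewDir At) (hAtP : IsPeriodicDir At ((N * L ^ (k + 1) : ℕ) : ℤ))
    {a₀ a₁ : ℝ} (ha₀ : 0 ≤ a₀) (ha₁ : 0 ≤ a₁) (hAtα : ∀ (y : Site (d + 1)) (κ : Fin (d + 1)), ‖At y κ‖ ≤ a₀)
    (hAt1 : ∀ (y : Site (d + 1)) (κ τ : Fin (d + 1)), ‖At (y + e τ) κ - At y κ‖ ≤ a₁)
    (hagree : ∀ (y : Site (d + 1)) (κ : Fin (d + 1)),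
      torusSupNorm (fun _ : Fin (d + 1) => L ^ (k + 1) * N) (y - z) ≤ (((nbRad (d + 1) L + 2 * ℓ + 10) * L ^ (k + 1) : ℕ) : ℝ) →
        gaugeAct u U y κ = vary (flat (d := d + 1) (n := n)) At 1 y κ)
    -- F51 ∕ F259 smallness of `M·a₀`
    (hσ : 4 * (3 + 12 * ((d + 1 : ℕ) : ℝ)) ^ 2 * (L : ℝ) ^ (k + 1) * a₀ ≤ rho0 (d + 1) L ^ 2)
    (hS1 : (8 * (3 + 12 * ((d + 1 : ℕ) : ℝ)) * (2 + 2 * ((((d + 1 : ℕ) : ℝ) + 1) * L)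
        * (1 + ((1250 * ((nbRad (d + 1) L : ℝ) + L) + 8 * (((d + 1 : ℕ) : ℝ) * L) + 2 * L) * (((d + 1 : ℕ) : ℝ) * (2 * nbRad (d + 1) L + 1) ^ (d + 1)))
          / ((L : ℝ) / (L : ℝ) ^ (d + 1))))) * ((L : ℝ) ^ (k + 1) * a₀) ≤ 1)
    (hb : 256 * (((d + 1 : ℕ) : ℝ) + 1) * L * (3 + 12 * ((d + 1 : ℕ) : ℝ)) * ((L : ℝ) ^ (k + 1) * a₀) ≤ 1)
    -- the numeric line at these constants (`K, c` are F263's slice-solver constants)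
    {K c c₀ θ : ℝ}
    (hlinek : K * (L : ℝ) ^ (k + 1) * (((r * ((L : ℝ) ^ (k + 1) * a₀) * ((curl1C (d + 1) L / (1 - thetaLoc (d + 1) L * ε))
                * (2 * (8 * (3 + 12 * ((d + 1 : ℕ) : ℝ)) * (2 + 2 * ((((d + 1 : ℕ) : ℝ) + 1) * L)
                  * (1 + ((1250 * ((nbRad (d + 1) L : ℝ) + L) + 8 * (((d + 1 : ℕ) : ℝ) * L) + 2 * L)
                      * (((d + 1 : ℕ) : ℝ) * (2 * nbRad (d + 1) L + 1) ^ (d + 1))) / ((L : ℝ) / (L : ℝ) ^ (d + 1)))))))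
              / ((L : ℝ) ^ (k + 1)) ^ 3
            + ((Fintype.card (T4AveragingDeficitWall.Plane (d + 1)) : ℝ)
              * (2 * (8 * a₀ * (2 * a₁ + 28 * a₀ ^ 2) + 6 * (Real.exp a₀ - 1) * (2 * a₁ + 24 * (Real.exp a₀ - 1) * a₀)
                  + (2 * a₁ + 24 * (Real.exp a₀ - 1) * a₀) * (2 * a₁ + 28 * a₀ ^ 2) + 960 * (Real.exp a₀ - 1) * a₀ ^ 2)
                + 64 * a₀ * a₁))
            + ((Fintype.card (T4AveragingDeficitWall.Plane (d + 1)) : ℝ)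
              * (2 * (8 * a₀ * (2 * (a₁ + 1 / (L : ℝ) ^ (k + 1) * a₀) + 28 * a₀ ^ 2)
                  + 6 * (Real.exp a₀ - 1) * (2 * (a₁ + 1 / (L : ℝ) ^ (k + 1) * a₀) + 24 * (Real.exp a₀ - 1) * a₀)
                  + (2 * (a₁ + 1 / (L : ℝ) ^ (k + 1) * a₀) + 24 * (Real.exp a₀ - 1) * a₀) * (2 * (a₁ + 1 / (L : ℝ) ^ (k + 1) * a₀) + 28 * a₀ ^ 2)
                  + 960 * (Real.exp a₀ - 1) * a₀ ^ 2)
                + 64 * a₀ * (a₁ + 1 / (L : ℝ) ^ (k + 1) * a₀)))) + ((Fintype.card (T4AveragingDeficitWall.Plane (d + 1)) : ℝ)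
              * (2 * (8 * a₀ * (2 * (a₁ + 1 / (L : ℝ) ^ (k + 1) * a₀) + 28 * a₀ ^ 2) + 6 * (Real.exp a₀ - 1) * (2 * (a₁ + 1 / (L : ℝ) ^ (k + 1) * a₀) + 24 * (Real.exp a₀ - 1) * a₀)
                  + (2 * (a₁ + 1 / (L : ℝ) ^ (k + 1) * a₀) + 24 * (Real.exp a₀ - 1) * a₀) * (2 * (a₁ + 1 / (L : ℝ) ^ (k + 1) * a₀) + 28 * a₀ ^ 2) + 960 * (Real.exp a₀ - 1) * a₀ ^ 2)
                + 64 * a₀ * (a₁ + 1 / (L : ℝ) ^ (k + 1) * a₀))))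
              + Real.exp (-(c * ℓ)) * (((r * ((L : ℝ) ^ (k + 1) * a₀) * ((curl1C (d + 1) L / (1 - thetaLoc (d + 1) L * ε))
                * (2 * (8 * (3 + 12 * ((d + 1 : ℕ) : ℝ)) * (2 + 2 * ((((d + 1 : ℕ) : ℝ) + 1) * L)
                  * (1 + ((1250 * ((nbRad (d + 1) L : ℝ) + L) + 8 * (((d + 1 : ℕ) : ℝ) * L) + 2 * L)
                      * (((d + 1 : ℕ) : ℝ) * (2 * nbRad (d + 1) L + 1) ^ (d + 1))) / ((L : ℝ) / (L : ℝ) ^ (d + 1)))))))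
              / ((L : ℝ) ^ (k + 1)) ^ 3
            + ((Fintype.card (T4AveragingDeficitWall.Plane (d + 1)) : ℝ)
              * (2 * (8 * a₀ * (2 * a₁ + 28 * a₀ ^ 2) + 6 * (Real.exp a₀ - 1) * (2 * a₁ + 24 * (Real.exp a₀ - 1) * a₀)
                  + (2 * a₁ + 24 * (Real.exp a₀ - 1) * a₀) * (2 * a₁ + 28 * a₀ ^ 2) + 960 * (Real.exp a₀ - 1) * a₀ ^ 2)
                + 64 * a₀ * a₁))
            + ((Fintype.card (T4AveragingDeficitWall.Plane (d + 1)) : ℝ)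
              * (2 * (8 * a₀ * (2 * (a₁ + 1 / (L : ℝ) ^ (k + 1) * a₀) + 28 * a₀ ^ 2)
                  + 6 * (Real.exp a₀ - 1) * (2 * (a₁ + 1 / (L : ℝ) ^ (k + 1) * a₀) + 24 * (Real.exp a₀ - 1) * a₀)
                  + (2 * (a₁ + 1 / (L : ℝ) ^ (k + 1) * a₀) + 24 * (Real.exp a₀ - 1) * a₀) * (2 * (a₁ + 1 / (L : ℝ) ^ (k + 1) * a₀) + 28 * a₀ ^ 2)
                  + 960 * (Real.exp a₀ - 1) * a₀ ^ 2)
                + 64 * a₀ * (a₁ + 1 / (L : ℝ) ^ (k + 1) * a₀))))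
            + r * (curl1C (d + 1) L / (1 - thetaLoc (d + 1) L * ε)) / ((L : ℝ) ^ (k + 1)) ^ 3
            + 2 * (Fintype.card (T4AveragingDeficitWall.Plane (d + 1)) : ℝ)
              * (2 * (1 / (L : ℝ) ^ (k + 1)) * a₁ + 2 / ((L : ℝ) ^ (k + 1)) ^ 2 * a₀)) + ((Fintype.card (T4AveragingDeficitWall.Plane (d + 1)) : ℝ)
              * (2 * (8 * a₀ * (2 * (a₁ + 1 / (L : ℝ) ^ (k + 1) * a₀) + 28 * a₀ ^ 2) + 6 * (Real.exp a₀ - 1) * (2 * (a₁ + 1 / (L : ℝ) ^ (k + 1) * a₀) + 24 * (Real.exp a₀ - 1) * a₀)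
                  + (2 * (a₁ + 1 / (L : ℝ) ^ (k + 1) * a₀) + 24 * (Real.exp a₀ - 1) * a₀) * (2 * (a₁ + 1 / (L : ℝ) ^ (k + 1) * a₀) + 28 * a₀ ^ 2) + 960 * (Real.exp a₀ - 1) * a₀ ^ 2)
                + 64 * a₀ * (a₁ + 1 / (L : ℝ) ^ (k + 1) * a₀)))))
            + Fintype.card n * ((2 * (CdecD d * (((d : ℝ) + 1) * (2 * ((d : ℝ) + 1))
              * ((2 + 32 / (kappa163 (d + 1) / (d + 1)) ^ 2) * latticeConst (d + 1) (kappa163 (d + 1) / (d + 1) / 2)))))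
                / ((L ^ (k + 1) : ℕ) : ℝ) * ((1 + 12 * ((d : ℝ) + 1)) * (β' + 28 * ((3 + 12 * ((d + 1 : ℕ) : ℝ)) * ((L : ℝ) ^ (k + 1) * a₀)
              + 4 * (3 + 12 * ((d + 1 : ℕ) : ℝ)) ^ 3 / rho0 (d + 1) L ^ 2 * ((L : ℝ) ^ (k + 1) * a₀) ^ 2) ^ 2
              + 4 * (4 * (3 + 12 * ((d + 1 : ℕ) : ℝ)) ^ 3 / rho0 (d + 1) L ^ 2 * ((L : ℝ) ^ (k + 1) * a₀) ^ 2)) / ((L ^ (k + 1) : ℕ) : ℝ))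
              + (((L ^ (k + 1) : ℕ) : ℝ))⁻¹ * (2 * (CdecD d * ((((d : ℝ) + 1) / ((L ^ (k + 1) : ℕ) : ℝ))
                * (((3 + 12 * ((d + 1 : ℕ) : ℝ)) * (L : ℝ) ^ (k + 1) * a₀
            + ((d : ℝ) + 1) * (4 * ((ℓ + 1 : ℕ) : ℝ) + 2) * (2 * ((3 + 12 * ((d + 1 : ℕ) : ℝ)) * (L : ℝ) ^ (k + 1) * a₀)
              + (β' + 28 * ((3 + 12 * ((d + 1 : ℕ) : ℝ)) * ((L : ℝ) ^ (k + 1) * a₀)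
                + 4 * (3 + 12 * ((d + 1 : ℕ) : ℝ)) ^ 3 / rho0 (d + 1) L ^ 2 * ((L : ℝ) ^ (k + 1) * a₀) ^ 2) ^ 2
                + 4 * (4 * (3 + 12 * ((d + 1 : ℕ) : ℝ)) ^ 3 / rho0 (d + 1) L ^ 2 * ((L : ℝ) ^ (k + 1) * a₀) ^ 2)))) * latticeConst (d + 1) (kappa163 (d + 1) / (d + 1) / 2) * Real.exp (-(kappa163 (d + 1) / (d + 1) / 2 * ℓ)))))))
            + 28 * a₀ ^ 2 ≤ (c₀ + θ * r) / ((L : ℝ) ^ (k + 1)) ^ 2) :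
        ∃ (A φ₁ E : Site (d + 1) → Fin (d + 1) → Matrix n n ℂ) (α₀ α₁ τn τf g s ℓ : ℝ) (u : Site (d + 1) → (Matrix n n ℂ)ˣ),
          -- the chart, cut off ((N1)-weak + cutoff)
          (IsSkewDir A ∧ IsPeriodicDir A ((N * L ^ (k + 1) : ℕ) : ℤ) ∧ 0 ≤ α₀ ∧ 0 ≤ α₁ ∧ (∀ y κ, ‖A y κ‖ ≤ α₀) ∧
            (∀ (y : Site (d + 1)) (κ τ' : Fin (d + 1)), ‖A (y + e τ') κ - A y κ‖ ≤ α₁)) ∧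
          -- the SPLIT of its linearised top average: near datum `φ₁` (coarse curl `ĝ`), far remainder `E` (size `s`, zero within `ℓ` blocks of the plaquette's block)
          (dirIter L (k + 1) (flat (d := d + 1) (n := n)) A = φ₁ + E ∧ IsPeriodicDir φ₁ (N : ℤ) ∧
            (∀ (y : Site (d + 1)) (μ' ν' : Fin (d + 1)), ‖curlAt (flat (d := d + 1) (n := n)) φ₁ y μ' ν'‖ ≤ g) ∧ 0 ≤ s ∧
            (∀ (y : Tor (fun _ : Fin (d + 1) => N)) (lam : Fin (d + 1)), ‖E (rep (fun _ : Fin (d + 1) => N) y) lam‖ ≤ s) ∧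
            (∀ (y : Tor (fun _ : Fin (d + 1) => N)), torusSupNorm (fun _ : Fin (d + 1) => N) (rep (fun _ : Fin (d + 1) => N) y
                - rep (fun _ : Fin (d + 1) => N) (B5Blocks16.blockOf (L ^ (k + 1)) (fun _ : Fin (d + 1) => N)
                            (toT (fine (L ^ (k + 1)) (fun _ : Fin (d + 1) => N)) z))) < ℓ →
              ∀ lam : Fin (d + 1), E (rep (fun _ : Fin (d + 1) => N) y) lam = 0)) ∧
          -- the two-region criticality defect ON STRAIGHT-TANGENT TESTS ((N2)), far threshold `ℓ`
          (0 ≤ τn ∧ 0 ≤ τf ∧ ∀ Y : Site (d + 1) → Fin (d + 1) → Matrix n n ℂ, IsSkewDir Y → IsPeriodicDir Y ((N * L ^ (k + 1) : ℕ) : ℤ) →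
            (Qcoarse L)^[k + 1] Y = 0 →
            |dAction (vary (flat (d := d + 1) (n := n)) A 1) Y (perWin (d + 1) (N * L ^ (k + 1)))|
              ≤ τn * dirL1 Y ((periodBox (d := d + 1) (N * L ^ (k + 1))).filter (fun x => ¬ (ℓ
                    ≤ torusSupNorm (fun _ : Fin (d + 1) => N) ((fun i => x i / ((L ^ (k + 1) : ℕ) : ℤ))
                        - rep (fun _ : Fin (d + 1) => N) (B5Blocks16.blockOf (L ^ (k + 1)) (fun _ : Fin (d + 1) => N)
                            (toT (fine (L ^ (k + 1)) (fun _ : Fin (d + 1) => N)) z))))))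
                + τf * dirL1 Y ((periodBox (d := d + 1) (N * L ^ (k + 1))).filter (fun x => ℓ
                    ≤ torusSupNorm (fun _ : Fin (d + 1) => N) ((fun i => x i / ((L ^ (k + 1) : ℕ) : ℤ))
                        - rep (fun _ : Fin (d + 1) => N) (B5Blocks16.blockOf (L ^ (k + 1)) (fun _ : Fin (d + 1) => N)
                            (toT (fine (L ^ (k + 1)) (fun _ : Fin (d + 1) => N)) z)))))) ∧
          -- the gauge matching `U` to `e^{A}` on the four bonds of the plaquette
          (IsUnitarySite u ∧ gaugeAct u U z μ = vary (flat (d := d + 1) (n := n)) A 1 z μ ∧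
            gaugeAct u U (z + e μ) ν = vary (flat (d := d + 1) (n := n)) A 1 (z + e μ) ν ∧
            gaugeAct u U (z + e ν) μ = vary (flat (d := d + 1) (n := n)) A 1 (z + e ν) μ ∧
            gaugeAct u U z ν = vary (flat (d := d + 1) (n := n)) A 1 z ν) ∧
          -- the numeric line
          K * (L : ℝ) ^ (k + 1) * ((τn + ((Fintype.card (T4AveragingDeficitWall.Plane (d + 1)) : ℝ)
              * (2 * (8 * α₀ * (2 * α₁ + 28 * α₀ ^ 2) + 6 * (Real.exp α₀ - 1) * (2 * α₁ + 24 * (Real.exp α₀ - 1) * α₀)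
                  + (2 * α₁ + 24 * (Real.exp α₀ - 1) * α₀) * (2 * α₁ + 28 * α₀ ^ 2) + 960 * (Real.exp α₀ - 1) * α₀ ^ 2)
                + 64 * α₀ * α₁)))
              + Real.exp (-(c * ℓ)) * (τf + ((Fintype.card (T4AveragingDeficitWall.Plane (d + 1)) : ℝ)
              * (2 * (8 * α₀ * (2 * α₁ + 28 * α₀ ^ 2) + 6 * (Real.exp α₀ - 1) * (2 * α₁ + 24 * (Real.exp α₀ - 1) * α₀)
                  + (2 * α₁ + 24 * (Real.exp α₀ - 1) * α₀) * (2 * α₁ + 28 * α₀ ^ 2) + 960 * (Real.exp α₀ - 1) * α₀ ^ 2)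
                + 64 * α₀ * α₁))))
            + Fintype.card n * ((2 * (CdecD d * (((d : ℝ) + 1) * (2 * ((d : ℝ) + 1))
              * ((2 + 32 / (kappa163 (d + 1) / (d + 1)) ^ 2) * latticeConst (d + 1) (kappa163 (d + 1) / (d + 1) / 2)))))
                / ((L ^ (k + 1) : ℕ) : ℝ) * (g / ((L ^ (k + 1) : ℕ) : ℝ))
              + (((L ^ (k + 1) : ℕ) : ℝ))⁻¹ * (2 * (CdecD d * ((((d : ℝ) + 1) / ((L ^ (k + 1) : ℕ) : ℝ))
                * (s * latticeConst (d + 1) (kappa163 (d + 1) / (d + 1) / 2) * Real.exp (-(kappa163 (d + 1) / (d + 1) / 2 * ℓ)))))))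
            + 28 * α₀ ^ 2 ≤ (c₀ + θ * r) / ((L : ℝ) ^ (k + 1)) ^ 2 := by
  obtain ⟨A, φ₁, E, hC1, hC2, hC3, hC4⟩ := exists_bundle_of_chart (n := n) hL k hℓ hN hε hLS hθ hθl hε1 hr hβ' hUu hUP hUε hUr havg hD hcrit z μ ν
    hu huP hAt hAtP ha₀ ha₁ hAtα hAt1 hagree hσ hS1 hb
  obtain ⟨hτn, hτf⟩ := densities_nonneg (d := d) hL k (ε := ε) (r := r) (a₀ := a₀) (a₁ := a₁) hθl hr ha₀ ha₁
  exact ⟨A, φ₁, E, a₀, a₁ + 1 / (L : ℝ) ^ (k + 1) * a₀, _, _, _, _, (ℓ : ℝ), u, hC1, hC2, ⟨hτn, hτf, hC3⟩, hC4, hlinek⟩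

/-- **`hape` FROM THE LOCAL CHART AND THE SCALAR LINE** (statement: module docstring; the conclusion is F263's, i.e. [Balaban1985Variational] Prop. 8 TYPE for the
class `sfClass (d+1) L N ε`, data of plaquette radius `4(e^β − 1)`, current radius `δ`, improved radius `δ₁`). [cite: Balaban1985Variational, Prop. 8 p.304] -/
theorem hape_of_localChart [Nonempty n] {L : ℕ} [NeZero L] (hL : 2 ≤ L) :
    ∃ K c : ℝ, 0 ≤ K ∧ 0 < c ∧ ∀ (N ℓ : ℕ) [NeZero N] (ε δ δ₁ β c₀ θ C₀ C₁ : ℝ), 1 ≤ ℓ → 4 * ℓ + 12 ≤ N →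
    0 ≤ c₀ → 0 ≤ θ → θ < 1 → c₀ + θ * δ ≤ δ → c₀ / (1 - θ) < δ₁ → 0 ≤ β →
    -- the multi-level class smallness of `ε`
    0 ≤ ε → ε ≤ 1 → cruxC (d + 1) L * ε < 1 → thetaLoc (d + 1) L * ε < 1 → (∀ k : ℕ, LevelSmall (d + 1) L k (ε / ((L : ℝ) ^ (k + 1)) ^ 2)) →
    -- the chart constants and F51's smallness of `C₀·(δ + 4(e^β − 1) + ε)`
    0 ≤ C₀ → 0 ≤ C₁ →
    4 * (3 + 12 * ((d + 1 : ℕ) : ℝ)) ^ 2 * (C₀ * (δ + 4 * (Real.exp β - 1) + ε)) ≤ rho0 (d + 1) L ^ 2 →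
    (8 * (3 + 12 * ((d + 1 : ℕ) : ℝ)) * (2 + 2 * ((((d + 1 : ℕ) : ℝ) + 1) * L)
        * (1 + ((1250 * ((nbRad (d + 1) L : ℝ) + L) + 8 * (((d + 1 : ℕ) : ℝ) * L) + 2 * L) * (((d + 1 : ℕ) : ℝ) * (2 * nbRad (d + 1) L + 1) ^ (d + 1)))
          / ((L : ℝ) / (L : ℝ) ^ (d + 1))))) * (C₀ * (δ + 4 * (Real.exp β - 1) + ε)) ≤ 1 →
    256 * (((d + 1 : ℕ) : ℝ) + 1) * L * (3 + 12 * ((d + 1 : ℕ) : ℝ)) * (C₀ * (δ + 4 * (Real.exp β - 1) + ε)) ≤ 1 →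
    -- THE SCALAR LINE at the closed-form constants of F278 (asserted for nothing here; next file)
    (∀ (k : ℕ) (r a₀ a₁ : ℝ), 0 ≤ r → r ≤ δ → 0 ≤ a₀ → 0 ≤ a₁ →
      (L : ℝ) ^ (k + 1) * a₀ ≤ C₀ * (r + 4 * (Real.exp β - 1) + ε) → ((L : ℝ) ^ (k + 1)) ^ 2 * a₁ ≤ C₁ * (r + 4 * (Real.exp β - 1) + ε) →
      K * (L : ℝ) ^ (k + 1) * (((r * ((L : ℝ) ^ (k + 1) * a₀) * ((curl1C (d + 1) L / (1 - thetaLoc (d + 1) L * ε))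
                * (2 * (8 * (3 + 12 * ((d + 1 : ℕ) : ℝ)) * (2 + 2 * ((((d + 1 : ℕ) : ℝ) + 1) * L)
                  * (1 + ((1250 * ((nbRad (d + 1) L : ℝ) + L) + 8 * (((d + 1 : ℕ) : ℝ) * L) + 2 * L)
                      * (((d + 1 : ℕ) : ℝ) * (2 * nbRad (d + 1) L + 1) ^ (d + 1))) / ((L : ℝ) / (L : ℝ) ^ (d + 1)))))))
              / ((L : ℝ) ^ (k + 1)) ^ 3
            + ((Fintype.card (T4AveragingDeficitWall.Plane (d + 1)) : ℝ)
              * (2 * (8 * a₀ * (2 * a₁ + 28 * a₀ ^ 2) + 6 * (Real.exp a₀ - 1) * (2 * a₁ + 24 * (Real.exp a₀ - 1) * a₀)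
                  + (2 * a₁ + 24 * (Real.exp a₀ - 1) * a₀) * (2 * a₁ + 28 * a₀ ^ 2) + 960 * (Real.exp a₀ - 1) * a₀ ^ 2)
                + 64 * a₀ * a₁))
            + ((Fintype.card (T4AveragingDeficitWall.Plane (d + 1)) : ℝ)
              * (2 * (8 * a₀ * (2 * (a₁ + 1 / (L : ℝ) ^ (k + 1) * a₀) + 28 * a₀ ^ 2)
                  + 6 * (Real.exp a₀ - 1) * (2 * (a₁ + 1 / (L : ℝ) ^ (k + 1) * a₀) + 24 * (Real.exp a₀ - 1) * a₀)
                  + (2 * (a₁ + 1 / (L : ℝ) ^ (k + 1) * a₀) + 24 * (Real.exp a₀ - 1) * a₀) * (2 * (a₁ + 1 / (L : ℝ) ^ (k + 1) * a₀) + 28 * a₀ ^ 2)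
                  + 960 * (Real.exp a₀ - 1) * a₀ ^ 2)
                + 64 * a₀ * (a₁ + 1 / (L : ℝ) ^ (k + 1) * a₀)))) + ((Fintype.card (T4AveragingDeficitWall.Plane (d + 1)) : ℝ)
              * (2 * (8 * a₀ * (2 * (a₁ + 1 / (L : ℝ) ^ (k + 1) * a₀) + 28 * a₀ ^ 2) + 6 * (Real.exp a₀ - 1) * (2 * (a₁ + 1 / (L : ℝ) ^ (k + 1) * a₀) + 24 * (Real.exp a₀ - 1) * a₀)
                  + (2 * (a₁ + 1 / (L : ℝ) ^ (k + 1) * a₀) + 24 * (Real.exp a₀ - 1) * a₀) * (2 * (a₁ + 1 / (L : ℝ) ^ (k + 1) * a₀) + 28 * a₀ ^ 2) + 960 * (Real.exp a₀ - 1) * a₀ ^ 2)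
                + 64 * a₀ * (a₁ + 1 / (L : ℝ) ^ (k + 1) * a₀))))
              + Real.exp (-(c * ℓ)) * (((r * ((L : ℝ) ^ (k + 1) * a₀) * ((curl1C (d + 1) L / (1 - thetaLoc (d + 1) L * ε))
                * (2 * (8 * (3 + 12 * ((d + 1 : ℕ) : ℝ)) * (2 + 2 * ((((d + 1 : ℕ) : ℝ) + 1) * L)
                  * (1 + ((1250 * ((nbRad (d + 1) L : ℝ) + L) + 8 * (((d + 1 : ℕ) : ℝ) * L) + 2 * L)
                      * (((d + 1 : ℕ) : ℝ) * (2 * nbRad (d + 1) L + 1) ^ (d + 1))) / ((L : ℝ) / (L : ℝ) ^ (d + 1)))))))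
              / ((L : ℝ) ^ (k + 1)) ^ 3
            + ((Fintype.card (T4AveragingDeficitWall.Plane (d + 1)) : ℝ)
              * (2 * (8 * a₀ * (2 * a₁ + 28 * a₀ ^ 2) + 6 * (Real.exp a₀ - 1) * (2 * a₁ + 24 * (Real.exp a₀ - 1) * a₀)
                  + (2 * a₁ + 24 * (Real.exp a₀ - 1) * a₀) * (2 * a₁ + 28 * a₀ ^ 2) + 960 * (Real.exp a₀ - 1) * a₀ ^ 2)
                + 64 * a₀ * a₁))
            + ((Fintype.card (T4AveragingDeficitWall.Plane (d + 1)) : ℝ)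
              * (2 * (8 * a₀ * (2 * (a₁ + 1 / (L : ℝ) ^ (k + 1) * a₀) + 28 * a₀ ^ 2)
                  + 6 * (Real.exp a₀ - 1) * (2 * (a₁ + 1 / (L : ℝ) ^ (k + 1) * a₀) + 24 * (Real.exp a₀ - 1) * a₀)
                  + (2 * (a₁ + 1 / (L : ℝ) ^ (k + 1) * a₀) + 24 * (Real.exp a₀ - 1) * a₀) * (2 * (a₁ + 1 / (L : ℝ) ^ (k + 1) * a₀) + 28 * a₀ ^ 2)
                  + 960 * (Real.exp a₀ - 1) * a₀ ^ 2)
                + 64 * a₀ * (a₁ + 1 / (L : ℝ) ^ (k + 1) * a₀))))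
            + r * (curl1C (d + 1) L / (1 - thetaLoc (d + 1) L * ε)) / ((L : ℝ) ^ (k + 1)) ^ 3
            + 2 * (Fintype.card (T4AveragingDeficitWall.Plane (d + 1)) : ℝ)
              * (2 * (1 / (L : ℝ) ^ (k + 1)) * a₁ + 2 / ((L : ℝ) ^ (k + 1)) ^ 2 * a₀)) + ((Fintype.card (T4AveragingDeficitWall.Plane (d + 1)) : ℝ)
              * (2 * (8 * a₀ * (2 * (a₁ + 1 / (L : ℝ) ^ (k + 1) * a₀) + 28 * a₀ ^ 2) + 6 * (Real.exp a₀ - 1) * (2 * (a₁ + 1 / (L : ℝ) ^ (k + 1) * a₀) + 24 * (Real.exp a₀ - 1) * a₀)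
                  + (2 * (a₁ + 1 / (L : ℝ) ^ (k + 1) * a₀) + 24 * (Real.exp a₀ - 1) * a₀) * (2 * (a₁ + 1 / (L : ℝ) ^ (k + 1) * a₀) + 28 * a₀ ^ 2) + 960 * (Real.exp a₀ - 1) * a₀ ^ 2)
                + 64 * a₀ * (a₁ + 1 / (L : ℝ) ^ (k + 1) * a₀)))))
            + Fintype.card n * ((2 * (CdecD d * (((d : ℝ) + 1) * (2 * ((d : ℝ) + 1))
              * ((2 + 32 / (kappa163 (d + 1) / (d + 1)) ^ 2) * latticeConst (d + 1) (kappa163 (d + 1) / (d + 1) / 2)))))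
                / ((L ^ (k + 1) : ℕ) : ℝ) * ((1 + 12 * ((d : ℝ) + 1)) * ((4 * (Real.exp β - 1)) + 28 * ((3 + 12 * ((d + 1 : ℕ) : ℝ)) * ((L : ℝ) ^ (k + 1) * a₀)
              + 4 * (3 + 12 * ((d + 1 : ℕ) : ℝ)) ^ 3 / rho0 (d + 1) L ^ 2 * ((L : ℝ) ^ (k + 1) * a₀) ^ 2) ^ 2
              + 4 * (4 * (3 + 12 * ((d + 1 : ℕ) : ℝ)) ^ 3 / rho0 (d + 1) L ^ 2 * ((L : ℝ) ^ (k + 1) * a₀) ^ 2)) / ((L ^ (k + 1) : ℕ) : ℝ))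
              + (((L ^ (k + 1) : ℕ) : ℝ))⁻¹ * (2 * (CdecD d * ((((d : ℝ) + 1) / ((L ^ (k + 1) : ℕ) : ℝ))
                * (((3 + 12 * ((d + 1 : ℕ) : ℝ)) * (L : ℝ) ^ (k + 1) * a₀
            + ((d : ℝ) + 1) * (4 * ((ℓ + 1 : ℕ) : ℝ) + 2) * (2 * ((3 + 12 * ((d + 1 : ℕ) : ℝ)) * (L : ℝ) ^ (k + 1) * a₀)
              + ((4 * (Real.exp β - 1)) + 28 * ((3 + 12 * ((d + 1 : ℕ) : ℝ)) * ((L : ℝ) ^ (k + 1) * a₀)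
                + 4 * (3 + 12 * ((d + 1 : ℕ) : ℝ)) ^ 3 / rho0 (d + 1) L ^ 2 * ((L : ℝ) ^ (k + 1) * a₀) ^ 2) ^ 2
                + 4 * (4 * (3 + 12 * ((d + 1 : ℕ) : ℝ)) ^ 3 / rho0 (d + 1) L ^ 2 * ((L : ℝ) ^ (k + 1) * a₀) ^ 2)))) * latticeConst (d + 1) (kappa163 (d + 1) / (d + 1) / 2) * Real.exp (-(kappa163 (d + 1) / (d + 1) / 2 * ℓ)))))))
            + 28 * a₀ ^ 2 ≤ (c₀ + θ * r) / ((L : ℝ) ^ (k + 1)) ^ 2) →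
    -- THE CHART (N1)-weak: [B8] Thm 2 at `U₀ = 1` on nested cubes, TYPE (asserted for nothing here)
    (∀ D : Site (d + 1) → Fin (d + 1) → (Matrix n n ℂ)ˣ, IsUnitaryCfg D → IsPeriodicCfg D (N : ℤ) → SmallField D (4 * (Real.exp β - 1)) →
      ∀ (k : ℕ), ∀ U ∈ admissible (sfClass (d + 1) L N ε) L (k + 1) D,
      (∀ φ : Site (d + 1) → Fin (d + 1) → Matrix n n ℂ, IsSkewDir φ → IsPeriodicDir φ ((N * L ^ (k + 1) : ℕ) : ℤ) → TangentIter L k U φ →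
        dAction U φ (perWin (d + 1) (N * L ^ (k + 1))) = 0) →
      ∀ r : ℝ, 0 ≤ r → r ≤ δ → SmallField U (r / ((L : ℝ) ^ (k + 1)) ^ 2) →
      ∀ z : Site (d + 1), ∃ (u : Site (d + 1) → (Matrix n n ℂ)ˣ) (At : Site (d + 1) → Fin (d + 1) → Matrix n n ℂ) (a₀ a₁ : ℝ),
        IsUnitarySite u ∧ (∀ (y : Site (d + 1)) (i : Fin (d + 1)), u (y + ((N * L ^ (k + 1) : ℕ) : ℤ) • e i) = u y) ∧
        IsSkewDir At ∧ IsPeriodicDir At ((N * L ^ (k + 1) : ℕ) : ℤ) ∧ 0 ≤ a₀ ∧ 0 ≤ a₁ ∧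
        (∀ (y : Site (d + 1)) (κ : Fin (d + 1)), ‖At y κ‖ ≤ a₀) ∧ (∀ (y : Site (d + 1)) (κ τ : Fin (d + 1)), ‖At (y + e τ) κ - At y κ‖ ≤ a₁) ∧
        (L : ℝ) ^ (k + 1) * a₀ ≤ C₀ * (r + 4 * (Real.exp β - 1) + ε) ∧ ((L : ℝ) ^ (k + 1)) ^ 2 * a₁ ≤ C₁ * (r + 4 * (Real.exp β - 1) + ε) ∧
        (∀ (y : Site (d + 1)) (κ : Fin (d + 1)),
          torusSupNorm (fun _ : Fin (d + 1) => L ^ (k + 1) * N) (y - z) ≤ (((nbRad (d + 1) L + 2 * ℓ + 10) * L ^ (k + 1) : ℕ) : ℝ) →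
            gaugeAct u U y κ = vary (flat (d := d + 1) (n := n)) At 1 y κ)) →
    ∀ D : Site (d + 1) → Fin (d + 1) → (Matrix n n ℂ)ˣ, IsUnitaryCfg D → IsPeriodicCfg D (N : ℤ) → SmallField D (4 * (Real.exp β - 1)) →
      ∀ (k : ℕ), ∀ U ∈ admissible (sfClass (d + 1) L N ε) L (k + 1) D, SmallField U (δ / ((L : ℝ) ^ (k + 1)) ^ 2) →
      (∀ φ : Site (d + 1) → Fin (d + 1) → Matrix n n ℂ, IsSkewDir φ → IsPeriodicDir φ ((N * L ^ (k + 1) : ℕ) : ℤ) → TangentIter L k U φ →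
        dAction U φ (perWin (d + 1) (N * L ^ (k + 1))) = 0) → SmallField U (δ₁ / ((L : ℝ) ^ (k + 1)) ^ 2) := by
  classical
  have hL1 : 1 ≤ L := by omega
  obtain ⟨K, c, hK, hc, hF⟩ := hape_of_torusRoadV4 (n := n) (d := d) (L := L) hL1
  refine ⟨K, c, hK, hc, ?_⟩
  intro N ℓ _ ε δ δ₁ β c₀ θ C₀ C₁ hℓ hN hc₀ hθ0 hθ1 hcδ hδ₁ hβ hε hε1 hθ hθl hLS hC₀ hC₁ hσ' hS1' hb' hline hchart
  refine hF N ε δ δ₁ β c₀ θ hc₀ hθ0 hθ1 hcδ hδ₁ ?_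
  intro D hDu hDP hDs k U hU hcrit r hr0 hrδ hUr z μ ν hμν
  -- the class facts of `U`
  have hUcl : U ∈ sfClass (d + 1) L N ε (k + 1) := hU.1
  have hUu : IsUnitaryCfg U := hUcl.1
  have hUP : IsPeriodicCfg U ((N * L ^ (k + 1) : ℕ) : ℤ) := hUcl.2.1
  have hUε : SmallField U (ε / ((L : ℝ) ^ (k + 1)) ^ 2) := hUcl.2.2
  have havg : cavgIter L (k + 1) U = D := by rw [cavgIter_eq_avgIter]; exact hU.2
  have hβ'0 : (0 : ℝ) ≤ 4 * (Real.exp β - 1) := by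
    have := Real.add_one_le_exp β; nlinarith
  -- the chart at `z`
  obtain ⟨u, At, a₀, a₁, hu, huP, hAt, hAtP, ha₀, ha₁, hAtα, hAt1, hMa₀, hMa₁, hagree⟩ := hchart D hDu hDP hDs k U hU hcrit r hr0 hrδ hUr z
  -- F51's smallness at this `a₀`
  have ht : C₀ * (r + 4 * (Real.exp β - 1) + ε) ≤ C₀ * (δ + 4 * (Real.exp β - 1) + ε) := mul_le_mul_of_nonneg_left (by linarith) hC₀
  have hMa₀' : (L : ℝ) ^ (k + 1) * a₀ ≤ C₀ * (δ + 4 * (Real.exp β - 1) + ε) := hMa₀.trans ht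
  have hKd0 : (0 : ℝ) ≤ (8 * (3 + 12 * ((d + 1 : ℕ) : ℝ)) * (2 + 2 * ((((d + 1 : ℕ) : ℝ) + 1) * L)
        * (1 + ((1250 * ((nbRad (d + 1) L : ℝ) + L) + 8 * (((d + 1 : ℕ) : ℝ) * L) + 2 * L) * (((d + 1 : ℕ) : ℝ) * (2 * nbRad (d + 1) L + 1) ^ (d + 1)))
          / ((L : ℝ) / (L : ℝ) ^ (d + 1))))) := by positivity
  have hσ : 4 * (3 + 12 * ((d + 1 : ℕ) : ℝ)) ^ 2 * (L : ℝ) ^ (k + 1) * a₀ ≤ rho0 (d + 1) L ^ 2 := by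
    have h1 : 4 * (3 + 12 * ((d + 1 : ℕ) : ℝ)) ^ 2 * ((L : ℝ) ^ (k + 1) * a₀) ≤ 4 * (3 + 12 * ((d + 1 : ℕ) : ℝ)) ^ 2 * (C₀ * (δ + 4 * (Real.exp β - 1) + ε)) :=
      mul_le_mul_of_nonneg_left hMa₀' (by positivity)
    linarith
  have hS1 : (8 * (3 + 12 * ((d + 1 : ℕ) : ℝ)) * (2 + 2 * ((((d + 1 : ℕ) : ℝ) + 1) * L)
        * (1 + ((1250 * ((nbRad (d + 1) L : ℝ) + L) + 8 * (((d + 1 : ℕ) : ℝ) * L) + 2 * L) * (((d + 1 : ℕ) : ℝ) * (2 * nbRad (d + 1) L + 1) ^ (d + 1)))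
          / ((L : ℝ) / (L : ℝ) ^ (d + 1))))) * ((L : ℝ) ^ (k + 1) * a₀) ≤ 1 := (mul_le_mul_of_nonneg_left hMa₀' hKd0).trans hS1'
  have hb : 256 * (((d + 1 : ℕ) : ℝ) + 1) * L * (3 + 12 * ((d + 1 : ℕ) : ℝ)) * ((L : ℝ) ^ (k + 1) * a₀) ≤ 1 :=
    (mul_le_mul_of_nonneg_left hMa₀' (by positivity)).trans hb'
  exact bundle_with_line_of_chart (n := n) hL k hℓ hN hε (hLS k) hθ hθl hε1 hr0 hβ'0 hUu hUP hUε hUr havg hDs hcrit z μ ν hu huP hAt hAtP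
    ha₀ ha₁ hAtα hAt1 hagree hσ hS1 hb (hline k r a₀ a₁ hr0 hrδ ha₀ ha₁ hMa₀ hMa₁)

end

end Summit.QuantumFields.BalabanUV.T4Continuum.NE7HapeOfLocalChart
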